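import Summits.HodgeConjecture.HodgeConjecture.Theorems.LinearSystemTorelliDefs
import Literature.AlgebraicGeometry.Motives.AbelianVarietyBlochPontryaginFiltration

/-!
# Route LinearSystemTorelli — Bloch's theorem (1976) discharges the lean `BlochPontryaginVanishing`

The Weil-type sector of the line `ch0-null-correspondence-support` of the crux
`MiddleDivisorSupport` (stmt-HodgeConjecture-1081) assumes BY NAME the route-side statement
`BlochPontryaginVanishing` (Defs module `LinearSystemTorelliDefs`): for a complex abelian variety
`A`, an endomorphism `φ`, a complex point `P` and `a + b > dim A`, the Pontryagin monomial
`pontryaginMonomial A φ P a b = Σ_{i ≤ a, j ≤ b} (-1)^{(a-i)+(b-j)} C(a,i) C(b,j) {(i·𝟙 + j·φ)(P)}`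
vanishes in `CH₀(A)`. This file proves that it is an INSTANCE of the published theorem, filed on
the tree's carriers as the Literature named fact
`Literature.AlgebraicGeometry.Motives.Bloch1976_pontryaginPower_eq_zero` (Bloch 1976, Thm. 0.1 =
Voisin II, Thm. 11.29: `I^{⋆(g+1)} = 0` for the augmentation ideal `I ⊆ CH₀(A)` of the Pontryagin
ring), via its two-block specialisation `Bloch1976_pontryaginPower_eq_zero.two_block` (the family
of `a` copies of `P` and `b` copies of `φ(P)`, translated by `R = 0`):

* `algPointsMap_nsmul_id_add_nsmul`: in the (multiplicatively written) group `A(ℂ)`,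
  `(x·𝟙_A + y·φ)(P) = P^x · φ(P)^y` — the additive structure of `End(A)` is the pointwise group
  law (`AbelianVariety.hom_add`, `MonObj.comp_mul`, `MonObj.comp_pow`);
* `blochPontryaginVanishing_of_bloch1976 :
    Bloch1976_pontryaginPower_eq_zero → BlochPontryaginVanishing`
  (registered sub-goal of stmt-HodgeConjecture-1081), making the sector's trust base the named
  published theorem instead of a route-side paraphrase.

## References

* [Bloch1976] S. Bloch, Some elementary theorems about algebraic cycles on Abelian varieties,
  Invent. Math. 37 (1976), Thm. 0.1.
* [VoisinHodgeII2003] C. Voisin, Hodge Theory and Complex Algebraic Geometry II, Thm. 11.29.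
-/

noncomputable section

-- `Summit.HodgeConjecture.HodgeConjecture.Theorems` is the mandated namespace (single-problem summit:
-- Problem = Summit), which `linter.dupNamespace` flags on every declaration; the lakefile turns the
-- linter off tree-wide (weak option), restated here so stand-alone elaboration is warning-free too.
set_option linter.dupNamespace false

namespace Summit.HodgeConjecture.HodgeConjecture.Theorems.Ch0Null

open CategoryTheory AlgebraicGeometry MonoidalCategory
open Literature.AlgebraicGeometry Literature.AlgebraicGeometry.HodgeTheory
open Literature.AlgebraicGeometry.Motives
open scoped BigOperators MonObj

/-- **`(x·𝟙_A + y·φ)(P) = x·P + y·φ(P)`** in the group `A(ℂ)` (written multiplicatively: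
`P ^ x * φ(P) ^ y`): the additive group structure on `Hom(A, A)` is the pointwise one transported
from Mathlib's `Hom.commGroup` (`AbelianVariety.hom_add`: `(f + g).hom = f.hom * g.hom`, hence
`(n • g).hom = g.hom ^ n`), and precomposition with a point is a monoid homomorphism
(`MonObj.comp_mul`, `MonObj.comp_pow`). [folklore] -/
theorem algPointsMap_nsmul_id_add_nsmul (A : AbelianVariety ℂ) (φ : A ⟶ A) (x y : ℕ)
    (P : A.Points ℂ) :
    AlgPoints.map (x • 𝟙 A + y • φ).hom.hom.hom P = P ^ x * AlgPoints.map φ.hom.hom.hom P ^ y := by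
  have hnsmul : ∀ (n : ℕ) (g : A ⟶ A), (n • g).hom = g.hom ^ n := fun _ _ => rfl
  rw [AlgPoints.map_apply, AlgPoints.map_apply, AbelianVariety.hom_add, hnsmul, hnsmul,
    Grp.Hom.hom_mul, Mon.Hom.hom_mul, MonObj.comp_mul, Grp.Hom.hom_pow, Grp.Hom.hom_pow,
    Mon.Hom.hom_pow, Mon.Hom.hom_pow, MonObj.comp_pow, MonObj.comp_pow, AbelianVariety.id_hom]
  rfl

/-- The point class `{(i·𝟙_A + j·φ)(P)}` of the Defs module is the class `{Pⁱ · φ(P)ʲ}` of the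
corresponding product in the group `A(ℂ)`. [folklore] -/
theorem endoPointClass_eq_ofPoint_pow_mul_pow (A : AbelianVariety ℂ) (φ : A ⟶ A) (i j : ℕ)
    (P : A.Points ℂ) :
    endoPointClass A φ i j P =
      ChowGroup.ofPoint (P ^ i * AlgPoints.map φ.hom.hom.hom P ^ j).pt
        (height_pt_eq_zero (P ^ i * AlgPoints.map φ.hom.hom.hom P ^ j)) := by
  unfold endoPointClass pointClass
  rw [algPointsMap_nsmul_id_add_nsmul]

/-- **Bloch's theorem discharges the sector's lean.** `BlochPontryaginVanishing` (the vanishing of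
the Pontryagin monomials `u^{⋆a} ⋆ v^{⋆b}`, `u = {P} - {0}`, `v = {φP} - {0}`, for `a + b > dim A`)
is the two-block specialisation of the named fact `Bloch1976_pontryaginPower_eq_zero` (Bloch 1976
Thm. 0.1, Voisin II Thm. 11.29) at `R = 0` (the unit `1` of `A(ℂ)`) and `Q = φ(P)`. Registered
sub-goal `blochPontryaginVanishing_of_bloch1976` of stmt-HodgeConjecture-1081. -/
theorem blochPontryaginVanishing_of_bloch1976 : Literature.AlgebraicGeometry.Motives.Bloch1976_pontryaginPower_eq_zero → BlochPontryaginVanishing := by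
  intro h A φ P a b hab
  have h2 := h.two_block A 1 P (AlgPoints.map φ.hom.hom.hom P) a b hab
  unfold pontryaginMonomial
  rw [← h2]
  refine Finset.sum_congr rfl fun i _ => Finset.sum_congr rfl fun j _ => ?_
  rw [endoPointClass_eq_ofPoint_pow_mul_pow, one_mul]

end Summit.HodgeConjecture.HodgeConjecture.Theorems.Ch0Null

end
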